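import Literature.MathematicalPhysics.QuantumLattice.LatticeGaugeDLRGibbsProofs
import Literature.MathematicalPhysics.QuantumLattice.LatticeGaugeDLRLimitPointsProofs
import Literature.Probability.Process.KrylovBogoliubovDiscrete
import HarnessLib

/-!
# Weak limits of locally-DLR states are DLR states, with convergence on measurable cylinders

Helper file for stub `stub_tubeLimitState` of crux `FibreToTorus` (stmt-QuantumFields-16244),
line `uniqueness`, route `ContractibleFibre`.  Abstract form of Georgii's Thm. 4.17 for the
lattice Yang–Mills (Wilson) specification `ymSpecification ρ β` on `ℤᵈ`: if probability measures
`P k` on `LGConfig d G` converge to `μ` on bounded continuous functions and each finite-volume DLR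
identity `∫ F dP_k = ∫ (γ_Λ F) dP_k` holds for all large `k` (bounded measurable cylinder `F`),
then `μ` is a DLR state and, moreover, `∫ F dP_k → ∫ F dμ` for every bounded MEASURABLE cylinder
observable `F` (not only continuous ones) — the kernel average `γ_Λ F` of a cylinder observable
supported inside `Λ` is continuous in the boundary condition.  The torus case of the first
conclusion is the landed `mem_ymGibbsMeasures_of_mem_infiniteVolumeLimitPoints_holds`, whose proof
is followed here step by step.
-/

noncomputable section

open MeasureTheory Filter Topology Finset
open Literature.Probability.LatticeModels
open Literature.MathematicalPhysics.QuantumLattice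
open Literature.MathematicalPhysics.QuantumFieldTheory (haarProbability)

namespace Summit.QuantumFields.YangMills.Theorems.FibreToTorus

variable {d N : ℕ} {G : Type*} [Group G] [TopologicalSpace G] [IsTopologicalGroup G]
  [CompactSpace G] [MeasurableSpace G] [BorelSpace G] (ρ : G →* Matrix (Fin N) (Fin N) ℂ)

/-- **Kernel averages of inner cylinder observables are continuous.** For a bounded measurable
cylinder observable `F` whose support `S₀` lies inside `Λ`, the kernel average
`η ↦ ∫ F dγ_Λ(· | η)` of the Wilson specification is continuous in the boundary condition `η`
(the glued configuration restricted to `S₀ ⊆ Λ` does not depend on `η`, and the Boltzmann factor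
is jointly continuous). [folklore] -/
theorem continuous_integral_ymSpecification_of_subset [SecondCountableTopology G]
    (hρ : Continuous ρ) (β : ℝ) (Λ : Finset (ZdEdge d))
    {F : LGConfig d G → ℝ} (hFm : Measurable F) {C : ℝ} (hC : ∀ U, |F U| ≤ C)
    {S₀ : Finset (ZdEdge d)} (hFS : IsCylinder F S₀) (hS : S₀ ⊆ Λ) :
    Continuous fun η => ∫ U, F U ∂(ymSpecification ρ β Λ η) := by
  have hw : Continuous fun U : LGConfig d G => Real.exp (-β * wilsonBoundaryAction ρ Λ U) :=
    Real.continuous_exp.comp (continuous_const.mul (continuous_wilsonBoundaryAction ρ hρ Λ))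
  obtain ⟨B, hB⟩ := exists_bound_of_continuous hw
  -- the observable part of the integrand does not see the boundary condition
  have hF0 : ∀ (ζ : ↥Λ → G) (η η' : LGConfig d G), F (glueWith Λ ζ η) = F (glueWith Λ ζ η') :=
    fun ζ η η' => hFS fun e he => by
      rw [glueWith_apply_mem _ _ _ (hS (Finset.mem_coe.1 he)),
        glueWith_apply_mem _ _ _ (hS (Finset.mem_coe.1 he))]
  have hnum : Continuous fun η : LGConfig d G =>
      ∫ ζ, F (glueWith Λ ζ η) * Real.exp (-β * wilsonBoundaryAction ρ Λ (glueWith Λ ζ η))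
        ∂(Measure.pi fun _ : ↥Λ => haarProbability G) := by
    refine continuous_of_dominated (bound := fun _ => C * B) ?_ ?_ (integrable_const _) ?_
    · intro η
      exact ((hFm.comp (measurable_glueWith Λ η)).mul
        (hw.measurable.comp (measurable_glueWith Λ η))).aestronglyMeasurable
    · intro η
      refine ae_of_all _ fun ζ => ?_
      rw [Real.norm_eq_abs, abs_mul]
      exact mul_le_mul (hC _) (hB _) (abs_nonneg _) ((abs_nonneg _).trans (hC (glueWith Λ ζ η)))
    · refine ae_of_all _ fun ζ => ?_
      have h1 : Continuous fun η : LGConfig d G =>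
          Real.exp (-β * wilsonBoundaryAction ρ Λ (glueWith Λ ζ η)) :=
        hw.comp ((continuous_glueWith_prod Λ).comp (Continuous.prodMk_left ζ))
      have h2 : (fun η : LGConfig d G =>
          F (glueWith Λ ζ η) * Real.exp (-β * wilsonBoundaryAction ρ Λ (glueWith Λ ζ η))) =
          fun η => F (glueWith Λ ζ (1 : LGConfig d G)) *
            Real.exp (-β * wilsonBoundaryAction ρ Λ (glueWith Λ ζ η)) :=
        funext fun η => by rw [hF0 ζ η 1]
      rw [h2]
      exact continuous_const.mul h1
  simp only [integral_ymSpecification ρ hρ β Λ hFm]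
  refine hnum.div ?_ fun η => (normaliser_pos ρ hρ β Λ η).ne'
  have h := continuous_integral_glueWith ρ hρ β Λ (F := fun _ => (1 : ℝ)) continuous_const
    (C := 1) (fun _ => by simp)
  simpa using h

/-- **Weak limits of locally-DLR states are DLR states; convergence extends to measurable
cylinder observables.** Let `P k` be probability measures on `LGConfig d G` converging to the
probability measure `μ` on all bounded continuous functions, and suppose that for every finite
edge set `Λ` and every bounded measurable cylinder observable `F` the finite-volume DLR identity
`∫ F dP_k = ∫ (γ_Λ F) dP_k` holds for all large `k`.  Then `μ ∈ ymGibbsMeasures ρ β` (Georgii 2011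
Thm. 4.17: Feller property + quasilocality, then `μ γ_Λ = μ` tested on bounded continuous
functions of the compact metrisable configuration space), and `∫ F dP_k → ∫ F dμ` for every
bounded measurable cylinder observable `F` (apply the hypotheses to the continuous bounded
cylinder observable `γ_{S₀} F` and use the DLR equation of `μ` in integral form). [folklore] -/
theorem mem_ymGibbsMeasures_of_tendsto_of_localDLR [T2Space G] [SecondCountableTopology G]
    (hρ : Continuous ρ) (β : ℝ) (P : ℕ → Measure (LGConfig d G))
    [∀ k, IsProbabilityMeasure (P k)] (μ : Measure (LGConfig d G)) [IsProbabilityMeasure μ]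
    (hlim : ∀ F : LGConfig d G → ℝ, Continuous F → (∃ C, ∀ U, |F U| ≤ C) →
      Tendsto (fun k => ∫ U, F U ∂P k) atTop (𝓝 (∫ U, F U ∂μ)))
    (hloc : ∀ (Λ S₀ : Finset (ZdEdge d)) (F : LGConfig d G → ℝ), Measurable F → IsCylinder F S₀ →
      ∀ C : ℝ, (∀ U, |F U| ≤ C) → ∀ᶠ k in atTop,
        ∫ U, F U ∂P k = ∫ η, (∫ U, F U ∂(ymSpecification ρ β Λ η)) ∂P k) :
    μ ∈ ymGibbsMeasures ρ β ∧
      ∀ (S₀ : Finset (ZdEdge d)) (F : LGConfig d G → ℝ), Measurable F → IsCylinder F S₀ →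
        ∀ C : ℝ, (∀ U, |F U| ≤ C) → Tendsto (fun k => ∫ U, F U ∂P k) atTop (𝓝 (∫ U, F U ∂μ)) := by
  classical
  have hγprob : ∀ (Λ : Finset (ZdEdge d)) (η : LGConfig d G),
      IsProbabilityMeasure (ymSpecification ρ β Λ η) :=
    isProbabilityMeasure_ymSpecification ρ hρ β
  -- Step 1: `μ(F) = μ(γ_Λ F)` for bounded continuous cylinder observables
  have core_cyl : ∀ (Λ : Finset (ZdEdge d)) (F : LGConfig d G → ℝ) (S₀ : Finset (ZdEdge d)),
      IsCylinder F S₀ → Continuous F → ∀ C : ℝ, (∀ U, |F U| ≤ C) →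
        ∫ U, F U ∂μ = ∫ η, (∫ U, F U ∂(ymSpecification ρ β Λ η)) ∂μ := by
    intro Λ F S₀ hFS hFc C hC
    have h1 := hlim F hFc ⟨C, hC⟩
    have h2 := hlim (fun η => ∫ U, F U ∂(ymSpecification ρ β Λ η))
      (continuous_integral_ymSpecification ρ hρ β Λ hFc hC)
      ⟨C, abs_integral_ymSpecification_le ρ hρ β Λ hC⟩
    exact tendsto_nhds_unique (h1.congr' (hloc Λ S₀ F hFc.measurable hFS C hC)) h2
  -- Step 2: extension to all bounded continuous observables by cylinder approximation
  have core : ∀ (Λ : Finset (ZdEdge d)) (F : LGConfig d G → ℝ), Continuous F → ∀ C : ℝ,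
      (∀ U, |F U| ≤ C) → ∫ U, F U ∂μ = ∫ η, (∫ U, F U ∂(ymSpecification ρ β Λ η)) ∂μ := by
    intro Λ F hFc C hC
    obtain ⟨T, hT⟩ := exists_piecewise_tendsto (E := ZdEdge d) (1 : LGConfig d G)
    have hpc : ∀ n, Continuous fun U : LGConfig d G => (T n).piecewise U 1 := fun n =>
      continuous_pi fun e => by
        by_cases he : e ∈ T n
        · simp only [Finset.piecewise_eq_of_mem _ _ _ he]; exact continuous_apply e
        · simp only [Finset.piecewise_eq_of_notMem _ _ _ he]; exact continuous_const
    have hcyl : ∀ n, IsCylinder (fun U => F ((T n).piecewise U 1)) (T n) := fun n U U' h =>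
      congrArg F ((T n).piecewise_congr (fun e he => h e (Finset.mem_coe.2 he)) fun _ _ => rfl)
    have hlim_μ : Tendsto (fun n => ∫ U, F ((T n).piecewise U 1) ∂μ) atTop (𝓝 (∫ U, F U ∂μ)) :=
      tendsto_integral_of_dominated_convergence (fun _ => C)
        (fun n => (hFc.comp (hpc n)).aestronglyMeasurable) (integrable_const C)
        (fun n => ae_of_all _ fun U => by simpa [Real.norm_eq_abs] using hC _)
        (ae_of_all _ fun U => (hFc.tendsto U).comp (hT U))
    have hlim_γ : ∀ η, Tendsto (fun n => ∫ U, F ((T n).piecewise U 1) ∂(ymSpecification ρ β Λ η))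
        atTop (𝓝 (∫ U, F U ∂(ymSpecification ρ β Λ η))) := fun η =>
      tendsto_integral_of_dominated_convergence (fun _ => C)
        (fun n => (hFc.comp (hpc n)).aestronglyMeasurable) (integrable_const C)
        (fun n => ae_of_all _ fun U => by simpa [Real.norm_eq_abs] using hC _)
        (ae_of_all _ fun U => (hFc.tendsto U).comp (hT U))
    have hlim_μγ : Tendsto (fun n => ∫ η, (∫ U, F ((T n).piecewise U 1)
        ∂(ymSpecification ρ β Λ η)) ∂μ) atTop
        (𝓝 (∫ η, (∫ U, F U ∂(ymSpecification ρ β Λ η)) ∂μ)) :=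
      tendsto_integral_of_dominated_convergence (fun _ => C)
        (fun n => (continuous_integral_ymSpecification ρ hρ β Λ (hFc.comp (hpc n))
          (fun U => hC _)).aestronglyMeasurable)
        (integrable_const C)
        (fun n => ae_of_all _ fun η => by
          simpa [Real.norm_eq_abs] using
            abs_integral_ymSpecification_le ρ hρ β Λ (F := fun U => F ((T n).piecewise U 1))
              (fun U => hC _) η)
        (ae_of_all _ hlim_γ)
    have heq : (fun n => ∫ U, F ((T n).piecewise U 1) ∂μ) = fun n =>
        ∫ η, (∫ U, F ((T n).piecewise U 1) ∂(ymSpecification ρ β Λ η)) ∂μ :=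
      funext fun n => core_cyl Λ _ (T n) (hcyl n) (hFc.comp (hpc n)) C fun U => hC _
    rw [heq] at hlim_μ
    exact tendsto_nhds_unique hlim_μ hlim_μγ
  -- Step 3: `μ = μ γ_Λ` as measures, tested on bounded continuous functions
  have hκ : ∀ Λ : Finset (ZdEdge d), Measurable (ymSpecification ρ β Λ) := fun Λ =>
    Measure.measurable_of_measurable_coe _ fun s hs =>
      measurable_ymSpecification_apply ρ hρ β Λ hs
  have hμeq : ∀ Λ : Finset (ZdEdge d), μ = μ.bind (ymSpecification ρ β Λ) := by
    intro Λ
    refine ext_of_forall_lintegral_eq_of_IsFiniteMeasure fun f => ?_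
    have hfm : Measurable fun x => (f x : ENNReal) :=
      measurable_coe_nnreal_ennreal.comp f.continuous.measurable
    rw [Measure.lintegral_bind (hκ Λ).aemeasurable hfm.aemeasurable]
    have hfc : Continuous fun x => (f x : ℝ) := NNReal.continuous_coe.comp f.continuous
    have hfb : ∀ x, |(f x : ℝ)| ≤ nndist f 0 := fun x => by
      rw [abs_of_nonneg (f x).coe_nonneg]
      exact_mod_cast BoundedContinuousFunction.NNReal.upper_bound f x
    have hint : ∀ (m : Measure (LGConfig d G)) [IsFiniteMeasure m],
        ∫⁻ x, (f x : ENNReal) ∂m = ENNReal.ofReal (∫ x, (f x : ℝ) ∂m) := by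
      intro m _
      rw [← BoundedContinuousFunction.toReal_lintegral_coe_eq_integral,
        ENNReal.ofReal_toReal (BoundedContinuousFunction.lintegral_lt_top_of_nnreal m f).ne]
    have hpt : (fun η => ∫⁻ x, (f x : ENNReal) ∂(ymSpecification ρ β Λ η)) = fun η =>
        ENNReal.ofReal (∫ x, (f x : ℝ) ∂(ymSpecification ρ β Λ η)) :=
      funext fun η => hint _
    rw [hint μ, hpt, ← ofReal_integral_eq_lintegral_ofReal]
    · rw [core Λ _ hfc _ hfb]
    · exact integrable_of_bound (continuous_integral_ymSpecification ρ hρ β Λ hfc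
        hfb).aestronglyMeasurable (abs_integral_ymSpecification_le ρ hρ β Λ hfb)
    · exact ae_of_all _ fun η => integral_nonneg fun x => (f x).coe_nonneg
  -- Step 4: the DLR equations
  have hGibbs : μ ∈ ymGibbsMeasures ρ β := by
    refine ⟨inferInstance, fun Λ A hA => ?_⟩
    calc ∫⁻ η, ymSpecification ρ β Λ η A ∂μ = (μ.bind (ymSpecification ρ β Λ)) A :=
          (Measure.bind_apply hA (hκ Λ).aemeasurable).symm
      _ = μ A := by rw [← hμeq Λ]
  refine ⟨hGibbs, fun S₀ F hFm hFS C hC => ?_⟩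
  -- Step 5: convergence on bounded measurable cylinder observables, through `γ_{S₀} F`
  have hγc : Continuous fun η => ∫ U, F U ∂(ymSpecification ρ β S₀ η) :=
    continuous_integral_ymSpecification_of_subset ρ hρ β S₀ hFm hC hFS Finset.Subset.rfl
  have hγb : ∀ η, |∫ U, F U ∂(ymSpecification ρ β S₀ η)| ≤ C :=
    abs_integral_ymSpecification_le ρ hρ β S₀ hC
  have h1 := hlim _ hγc ⟨C, hγb⟩
  -- the DLR equation of `μ` in integral form for the bounded measurable `F`
  let K : ProbabilityTheory.Kernel (LGConfig d G) (LGConfig d G) :=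
    ⟨ymSpecification ρ β S₀, hκ S₀⟩
  haveI : ProbabilityTheory.IsMarkovKernel K := ⟨fun η => hγprob S₀ η⟩
  have hμF : ∫ U, F U ∂μ = ∫ η, (∫ U, F U ∂(ymSpecification ρ β S₀ η)) ∂μ := by
    have h := Literature.Probability.Process.MarkovChain.integral_bind_eq_integral_integral K μ
      hFm.stronglyMeasurable (C := C) (fun U => by simpa [Real.norm_eq_abs] using hC U)
    have hb : μ.bind K = μ := (hμeq S₀).symm
    rw [hb] at h
    exact h
  rw [hμF]
  exact h1.congr' ((hloc S₀ S₀ F hFm hFS C hC).mono fun k hk => hk.symm)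

/-- **Registered form (sub-goal `tubeLimit_dlrLimit` of `stub_tubeLimitState`)** of
`mem_ymGibbsMeasures_of_tendsto_of_localDLR`: closed statement over `d, N, G, ρ`. [folklore] -/
theorem tubeLimit_dlrLimit : ∀ (d N : ℕ) (G : Type) [Group G] [TopologicalSpace G] [IsTopologicalGroup G] [CompactSpace G] [MeasurableSpace G] [BorelSpace G] [T2Space G] [SecondCountableTopology G] (ρ : G →* Matrix (Fin N) (Fin N) ℂ), Continuous ρ → ∀ (β : ℝ) (P : ℕ → MeasureTheory.Measure (LGConfig d G)), (∀ k, MeasureTheory.IsProbabilityMeasure (P k)) → ∀ (μ : MeasureTheory.Measure (LGConfig d G)), MeasureTheory.IsProbabilityMeasure μ → (∀ F : LGConfig d G → ℝ, Continuous F → (∃ C : ℝ, ∀ U, |F U| ≤ C) → Filter.Tendsto (fun k => ∫ U, F U ∂P k) Filter.atTop (nhds (∫ U, F U ∂μ))) → (∀ (Λ S₀ : Finset (ZdEdge d)) (F : LGConfig d G → ℝ), Measurable F → IsCylinder F S₀ → ∀ C : ℝ, (∀ U, |F U| ≤ C) → ∀ᶠ k in Filter.atTop, ∫ U, F U ∂P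 k = ∫ η, (∫ U, F U ∂(ymSpecification ρ β Λ η)) ∂P k) → μ ∈ ymGibbsMeasures ρ β ∧ ∀ (S₀ : Finset (ZdEdge d)) (F : LGConfig d G → ℝ), Measurable F → IsCylinder F S₀ → ∀ C : ℝ, (∀ U, |F U| ≤ C) → Filter.Tendsto (fun k => ∫ U, F U ∂P k) Filter.atTop (nhds (∫ U, F U ∂μ)) :=
  fun d _ _ _ _ _ _ _ _ _ _ ρ hρ β P _ μ _ hlim hloc =>
    mem_ymGibbsMeasures_of_tendsto_of_localDLR (d := d) ρ hρ β P μ hlim hloc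

end Summit.QuantumFields.YangMills.Theorems.FibreToTorus

end
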